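import Mathlib
import Summits.NavierStokesRegularity.NavierStokesRegularity.Theorems.TaylorModelRungThreeReadoutJets
import Summits.NavierStokesRegularity.NavierStokesRegularity.Theorems.TaylorModelRungThreeSoundness
import HarnessLib

/-!
# Certificate glue on a shift set `𝕊`, XVIII: THE LOHNER NODE STEP for a quadratic field — a parallelepiped node set
  `x + C ξ + e` is carried by the EXACT flow into `x' + C' ξ' + e'` under finitely many certificate clauses
  (helper for items stmt-NavierStokesRegularity-22987 `FlatGapCertificatesV2` and stmt-24295 K_A₂(64);
  cell harvest/h2-tao-ladder, p1 g14)

The analytic heart of a kernel-replayable Taylor-model / Lohner chain, stated ABSTRACTLY for any bilinear field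
`Q` on `Fin n → ℝ` with the weighted bound (B) (unit weights) — e.g. the truncated window field `QcN` of glue XVI —
directly from S1 (`TaylorModel.stub_soundness`, PROVED) and the generic jets `taylorJet` / `varJet`:

* `lohner_exists` — from every state of the node set `{x + C ξ + e : |ξ| ≤ r, |e| ≤ E₀}` the exact solution exists
  on `[0,h]` and stays in the majorant ball of radius `(m_C+ρ)/(1 − b (m_C+ρ) u)` (`ρ = ρ_C + E₀`), under the guard
  `b (m_C + ρ) h < 1`;
* `lohner_land` — EVERY solution on `[0,h]` from such a state ends in `{x' + C' ξ' + e' : |ξ'| ≤ r', |e'| ≤ E₁}`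
  with `ξ' := C'⁻¹ · Vap_h(C ξ)` provided the certificate clauses hold: centre Taylor defect `|TP_h(x) − x'| ≤ dP`,
  variational operator bound `NVh`, frame transport `|C'⁻¹ Vap_h(C ξ)| ≤ r'` on the `ξ`-box, exact right inverse
  `C' C'⁻¹ = 1`, and the E-RECURSION `dP + NVh·E₀ + Rem + RemV·ρ + Dev ≤ E₁` with the Cauchy-majorant remainders of S1.

Combined with glue XIV-b (`stepCert_of_flowStep'`, start/landing predicates) and glue X (mesh) this leaves, for a
Lohner-chain certificate of the A♭ / A₂(64) window systems, only ARITHMETIC obligations (jets at dyadic centres,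
interval matrix products, scalar inequalities).

HONEST FRAMING: abstract finite-dimensional ODE analysis (Taylor models with remainder, Lohner 1987 / Berz–Makino
1998 / Zgliczyński 2002, via the tree's S1); nothing about any particular table, no stub closed, nothing about the
Navier–Stokes equations.
-/

noncomputable section

-- the sub-problem namespace repeats the summit name by design (D-0017)
set_option linter.dupNamespace false

namespace Summit.NavierStokesRegularity.NavierStokesRegularity.Theorems

open Set Finset Summit.NavierStokesRegularity.NavierStokesRegularity.Theorems.TaylorModelReadout

namespace CertificateGlueOn

variable {n : ℕ} {Q : (Fin n → ℝ) → (Fin n → ℝ) → Fin n → ℝ} {b : ℝ}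

/-- The Taylor polynomial of the centre trajectory at time `u` (degree `p`). [cite: MakinoBerz2003, Definition 1 (Taylor model = polynomial + remainder bound)] -/
def TPoly (Q : (Fin n → ℝ) → (Fin n → ℝ) → Fin n → ℝ) (p : ℕ) (x : Fin n → ℝ) (u : ℝ) : Fin n → ℝ :=
  fun c => ∑ k ∈ Finset.range (p + 1), taylorJet Q x k c * u ^ k

/-- The variational Taylor polynomial at the centre, applied to `v`, at time `u` (degree `p`).
[cite: Zgliczynski2002C1Lohner, §3–4 (C¹-Lohner: the variational part)] -/
def VPoly (Q : (Fin n → ℝ) → (Fin n → ℝ) → Fin n → ℝ) (p : ℕ) (x v : Fin n → ℝ) (u : ℝ) : Fin n → ℝ :=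
  fun c => ∑ k ∈ Finset.range (p + 1), varJet Q x v k c * u ^ k

/-- `VPoly` is additive in `v` for a bilinear field. [folklore] -/
theorem VPoly_add (hQl : ∀ u, IsLinearMap ℝ (Q u)) (hQr : ∀ v, IsLinearMap ℝ (fun u => Q u v)) (p : ℕ)
    (x v v' : Fin n → ℝ) (u : ℝ) : VPoly Q p x (v + v') u = VPoly Q p x v u + VPoly Q p x v' u := by
  funext c
  simp only [VPoly, Pi.add_apply, ← Finset.sum_add_distrib]
  refine Finset.sum_congr rfl fun k _ => ?_
  rw [varJet_add Q x (fun a b b' => (hQl a).map_add b b') (fun a a' b => (hQr b).map_add a a') v v' k,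
    Pi.add_apply, add_mul]

/-- **Existence and the in-step majorant hull** from a parallelepiped node set (see the module docstring).
[cite: BerzMakino1998, §2–3 (verified integration of ODE flows by Taylor models: Picard/majorant step)] -/
theorem lohner_exists (hQl : ∀ u, IsLinearMap ℝ (Q u)) (hQr : ∀ v, IsLinearMap ℝ (fun u => Q u v))
    (hb : 0 ≤ b)
    (hB : ∀ (u v : Fin n → ℝ) (Nu Nv : ℝ), 0 ≤ Nu → 0 ≤ Nv → (∀ c, |u c| ≤ Nu * (fun _ => (1 : ℝ)) c) →
      (∀ c, |v c| ≤ Nv * (fun _ => (1 : ℝ)) c) → ∀ c, |Q u v c| ≤ b * Nu * Nv * (fun _ => (1 : ℝ)) c)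
    {h mC ρ : ℝ} {x : Fin n → ℝ} (hh : 0 ≤ h) (hmC : 0 ≤ mC) (hρ : 0 ≤ ρ) (hx : ∀ c, |x c| ≤ mC)
    (hguard : b * (mC + ρ) * h < 1) :
    ∀ v : Fin n → ℝ, (∀ c, |v c| ≤ ρ) → ∃ ψ : ℝ → Fin n → ℝ, ψ 0 = x + v ∧
      (∀ s ∈ Icc 0 h, HasDerivWithinAt ψ (Q (ψ s) (ψ s)) (Icc 0 h) s) ∧
      (∀ s ∈ Icc 0 h, ∀ c, |ψ s c| ≤ (mC + ρ) / (1 - b * (mC + ρ) * s)) := by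
  intro v hv
  obtain ⟨Φ, hΦ0, -, hΦ⟩ :=
    Summit.NavierStokesRegularity.NavierStokesRegularity.Theorems.TaylorModel.stub_soundness n Q (fun _ => 1) b
      (taylorJet Q) (varJet Q) (fun _ => one_pos) hb hQl hQr hB (taylorJet_zero Q) (taylorJet_succ_apply Q)
      (varJet_zero Q) (varJet_succ_apply Q)
  have hy : ∀ c, |(x + v) c| ≤ (mC + ρ) * (fun _ => (1 : ℝ)) c := fun c => by
    simp only [Pi.add_apply, mul_one]
    exact (abs_add_le _ _).trans (add_le_add (hx c) (hv c))
  obtain ⟨hsol, -, hval, -⟩ := hΦ (x + v) (mC + ρ) h (by positivity) hy hh hguard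
  exact ⟨Φ (x + v), hΦ0 _, hsol, fun s hs c => by simpa using hval s hs c⟩

/-- **THE LOHNER LANDING**: every solution on `[0,h]` from the parallelepiped node set lands in the next
parallelepiped (see the module docstring for the clauses). [cite: Zgliczynski2002C1Lohner, §3–4 (Lohner-type parallelepiped frames and the C¹/variational enclosure)] -/
theorem lohner_land (hQl : ∀ u, IsLinearMap ℝ (Q u)) (hQr : ∀ v, IsLinearMap ℝ (fun u => Q u v))
    (hb : 0 ≤ b)
    (hB : ∀ (u v : Fin n → ℝ) (Nu Nv : ℝ), 0 ≤ Nu → 0 ≤ Nv → (∀ c, |u c| ≤ Nu * (fun _ => (1 : ℝ)) c) →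
      (∀ c, |v c| ≤ Nv * (fun _ => (1 : ℝ)) c) → ∀ c, |Q u v c| ≤ b * Nu * Nv * (fun _ => (1 : ℝ)) c)
    {p : ℕ} {h mC ρC E₀ E₁ dP NVh : ℝ} {x x' : Fin n → ℝ} {C Cn Cin : Matrix (Fin n) (Fin n) ℝ}
    {r r' : Fin n → ℝ} (hh : 0 ≤ h) (hmC : 0 ≤ mC) (hρC : 0 ≤ ρC) (hE₀ : 0 ≤ E₀) (hx : ∀ c, |x c| ≤ mC)
    (hguard : b * (mC + (ρC + E₀)) * h < 1)
    (hC : ∀ ξ : Fin n → ℝ, (∀ c, |ξ c| ≤ r c) → ∀ c, |C.mulVec ξ c| ≤ ρC)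
    (hdP : ∀ c, |TPoly Q p x h c - x' c| ≤ dP)
    (hNVh : ∀ (v : Fin n → ℝ) (N : ℝ), 0 ≤ N → (∀ c, |v c| ≤ N) → ∀ c, |VPoly Q p x v h c| ≤ NVh * N)
    (hframe : ∀ ξ : Fin n → ℝ, (∀ c, |ξ c| ≤ r c) → ∀ c, |Cin.mulVec (VPoly Q p x (C.mulVec ξ) h) c| ≤ r' c)
    (hinv : Cn * Cin = 1)
    (hE₁ : dP + NVh * E₀ + mC * (b * mC * h) ^ (p + 1) / (1 - b * mC * h) +
      (ρC + E₀) * ((((p : ℝ) + 2) * (b * mC * h) ^ (p + 1) - ((p : ℝ) + 1) * (b * mC * h) ^ (p + 2)) /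
        (1 - b * mC * h) ^ 2) +
      ((mC + (ρC + E₀)) / (1 - b * (mC + (ρC + E₀)) * h) - mC / (1 - b * mC * h) -
        (ρC + E₀) / (1 - b * mC * h) ^ 2) ≤ E₁) :
    ∀ (ξ e : Fin n → ℝ), (∀ c, |ξ c| ≤ r c) → (∀ c, |e c| ≤ E₀) →
      ∀ ψ : ℝ → Fin n → ℝ, ψ 0 = x + (C.mulVec ξ + e) →
        (∀ s ∈ Icc 0 h, HasDerivWithinAt ψ (Q (ψ s) (ψ s)) (Icc 0 h) s) →
          ∃ ξ' e' : Fin n → ℝ, (∀ c, |ξ' c| ≤ r' c) ∧ (∀ c, |e' c| ≤ E₁) ∧ ψ h = x' + (Cn.mulVec ξ' + e') := by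
  intro ξ e hξ he ψ hψ0 hψd
  set ρ := ρC + E₀ with hρ
  have hρ0 : 0 ≤ ρ := by positivity
  set v := C.mulVec ξ + e with hvdef
  have hv : ∀ c, |v c| ≤ ρ * (fun _ => (1 : ℝ)) c := fun c => by
    simp only [hvdef, Pi.add_apply, mul_one, hρ]
    exact (abs_add_le _ _).trans (add_le_add (hC ξ hξ c) (he c))
  obtain ⟨Φ, hΦ0, huniq, hΦ⟩ :=
    Summit.NavierStokesRegularity.NavierStokesRegularity.Theorems.TaylorModel.stub_soundness n Q (fun _ => 1) b
      (taylorJet Q) (varJet Q) (fun _ => one_pos) hb hQl hQr hB (taylorJet_zero Q) (taylorJet_succ_apply Q)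
      (varJet_zero Q) (varJet_succ_apply Q)
  -- the solution is the selector from `x + v`
  have hψΦ : ψ h = Φ (x + v) h := huniq (x + v) h ψ hh hψ0 hψd h ⟨hh, le_rfl⟩
  -- S1 at the centre `x` with `m := mC`
  have hxw : ∀ c, |x c| ≤ mC * (fun _ => (1 : ℝ)) c := fun c => by simpa using hx c
  have hguard0 : b * mC * h < 1 := by
    have : b * mC * h ≤ b * (mC + ρ) * h := by
      have := mul_le_mul_of_nonneg_left (le_add_of_nonneg_right hρ0 : mC ≤ mC + ρ) hb
      exact mul_le_mul_of_nonneg_right this hh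
    linarith
  obtain ⟨-, -, -, hrem, hvar⟩ := hΦ x mC h hmC hxw hh hguard0
  have hhI : h ∈ Icc 0 h := ⟨hh, le_rfl⟩
  -- Taylor remainder at the centre
  have hR1 : ∀ c, |Φ x h c - TPoly Q p x h c| ≤ mC * (b * mC * h) ^ (p + 1) / (1 - b * mC * h) := fun c => by
    simpa [TPoly] using hrem h hhI p c
  -- second-order deviation + variational remainder
  obtain ⟨-, -, hdev, -⟩ := hvar v ρ hρ0 hv hguard
  have hR2 : ∀ c, |Φ (x + v) h c - Φ x h c - VPoly Q p x v h c| ≤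
      ((mC + ρ) / (1 - b * (mC + ρ) * h) - mC / (1 - b * mC * h) - ρ / (1 - b * mC * h) ^ 2 +
        ρ * ((((p : ℝ) + 2) * (b * mC * h) ^ (p + 1) - ((p : ℝ) + 1) * (b * mC * h) ^ (p + 2)) /
          (1 - b * mC * h) ^ 2)) := fun c => by
    simpa [VPoly] using hdev h hhI p c
  -- split the variational polynomial along `v = C ξ + e`
  have hsplit : VPoly Q p x v h = VPoly Q p x (C.mulVec ξ) h + VPoly Q p x e h := by
    rw [hvdef]; exact VPoly_add hQl hQr p x _ _ h
  -- the new frame coordinates and the remainder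
  set w := VPoly Q p x (C.mulVec ξ) h with hw
  set ξ' := Cin.mulVec w with hξ'
  have hCnξ' : Cn.mulVec ξ' = w := by
    rw [hξ', Matrix.mulVec_mulVec, hinv, Matrix.one_mulVec]
  refine ⟨ξ', ψ h - x' - Cn.mulVec ξ', hframe ξ hξ, fun c => ?_, by abel⟩
  -- the E-recursion
  have hVe : |VPoly Q p x e h c| ≤ NVh * E₀ := hNVh e E₀ hE₀ he c
  have e1 : (ψ h - x' - Cn.mulVec ξ') c =
      (Φ x h c - TPoly Q p x h c) + (TPoly Q p x h c - x' c) + VPoly Q p x e h c +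
        (Φ (x + v) h c - Φ x h c - VPoly Q p x v h c) := by
    rw [hψΦ, hCnξ', hw]
    have := congrFun hsplit c
    simp only [Pi.add_apply] at this
    simp only [Pi.sub_apply, this]
    ring
  rw [e1]
  have := hR1 c; have := hdP c; have := hR2 c
  calc |(Φ x h c - TPoly Q p x h c) + (TPoly Q p x h c - x' c) + VPoly Q p x e h c +
        (Φ (x + v) h c - Φ x h c - VPoly Q p x v h c)|
      ≤ |Φ x h c - TPoly Q p x h c| + |TPoly Q p x h c - x' c| + |VPoly Q p x e h c| +
        |Φ (x + v) h c - Φ x h c - VPoly Q p x v h c| := by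
          refine (abs_add_le _ _).trans (add_le_add ((abs_add_le _ _).trans (add_le_add (abs_add_le _ _) le_rfl)) le_rfl)
    _ ≤ E₁ := by rw [hρ] at hR2; linarith [hR1 c, hdP c, hVe, hR2 c, hE₁]

end CertificateGlueOn

end Summit.NavierStokesRegularity.NavierStokesRegularity.Theorems

end
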